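import Literature.Computability.FineGrained.BKGadgetStructure
import HarnessLib

/-!
# The Bringmann–Künnemann alignment gadget: Lemma 5.8 (distance of prefixes of `x` to `0^N`)

K. Bringmann, M. Künnemann, *Quadratic conditional lower bounds for string problems and dynamic
time warping*, FOCS 2015 (arXiv:1502.01063), §5.2, Lemma 5.8, for `c_subst = 1` (`ρ = 2`,
`β = 4/5`): for every prefix `x'` of `x = G(x₁) 0^{γ₂} ⋯ G(x_n)`,
`editDist x' 0^{nγ₃} ≥ nγ₃ - β|x'|`, with equality for `x' = G(x₁)0^{γ₂} ⋯ G(xᵢ)0^{γ₂}`, and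
symmetrically for suffixes. Multiplying by `5`, the statements proved here are

* `five_mul_le_editDist_take_gadgetX` / `five_mul_le_editDist_drop_gadgetX`:
  `5N ≤ 5·editDist x' 0^N + 4|x'|` for every prefix / suffix `x'` of `x` and every `N`;
* `editDist_flatten_blocks_zeros` / `editDist_flatten_blocks'_zeros`: for
  `x' = [G(a)0^{γ₂}]_{a∈as}` (resp. `[0^{γ₂}G(c)]_{c∈cs}`) and `|x'| ≤ N`,
  `editDist x' 0^N + 4·|as|·(4γ₁+sₓ) = N` (note `β|G(xᵢ)0^{γ₂}| = 4(4γ₁+sₓ)`).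

The printed proof: `editDist x' 0^N = #1(x') + (N - |x'|)` for `|x'| ≤ N` ("all zeroes of `x'` can
be matched to zeroes of `L`, while all ones have to be substituted; the remaining zeroes of `L`
have to be deleted" — `Cryptography.editDist_replicate_add_count`; for the inequality only
`N ≤ editDist x' 0^N + #0(x')` is needed, which holds without the length hypothesis), and the
relative number of ones of every prefix of `x` is at least `1/5`, with equality for the special
prefixes (`length_take_gadgetX_le_five_mul_count`: the block `(1^{γ₁}0^{γ₁})²` has density `≥ 1/2`
in every prefix, the rest of `G(xᵢ)0^{γ₂}` is controlled by the choice `γ₂ = 12γ₁ + 5sₓ - ℓₓ`).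
Suffixes are prefixes of the reversed string, which is again a gadget string
(`Params.reverse_gadgetX`).
-/

namespace Literature.Computability.FineGrained

open Cryptography

namespace BKGadget

namespace Params

variable (P : Params)

/-! ### Density of ones in prefixes of one block `G(z) 0^{γ₂}` -/

/-- Every prefix of the leading guard half `1^{γ₁}0^{γ₁}1^{γ₁}0^{γ₁}` has at least as many ones as
zeros (BK15, proof of Lemma 5.8: "any prefix of `(1^{γ₁}0^{γ₁})^ρ` has relative number of ones at
least `1/2`"). [cite: BringmannKunnemannFOCS2015, Lemma 5.8 (proof)] -/
theorem length_take_guardHead_le (t : ℕ) :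
    ((ones P.γ₁ ++ zeros P.γ₁ ++ ones P.γ₁ ++ zeros P.γ₁).take t).length ≤
      2 * ((ones P.γ₁ ++ zeros P.γ₁ ++ ones P.γ₁ ++ zeros P.γ₁).take t).count true := by
  simp only [List.append_assoc, List.take_append, List.length_append, List.count_append,
    zeros, ones, List.take_replicate, List.length_replicate, List.count_replicate_self,
    List.count_replicate]
  simp
  omega

/-- Every prefix `p` of the trailing part `0^{γ₁}1^{γ₁}0^{γ₁}1^{γ₁}0^{γ₂}` of a block satisfies
`|p| + 4γ₁ + ℓₓ ≤ 5#1(p) + 10γ₁ + 5sₓ` (BK15, proof of Lemma 5.8: the density of ones of a prefix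
of `G(xᵢ)0^{γ₂}` reaching beyond `xᵢ` stays `≥ 1/5`, with equality for the whole block, by the choice
of `γ₂`). [cite: BringmannKunnemannFOCS2015, Lemma 5.8 (proof)] -/
theorem length_take_guardTail_le (s : ℕ) :
    ((zeros P.γ₁ ++ ones P.γ₁ ++ zeros P.γ₁ ++ ones P.γ₁ ++ zeros P.γ₂).take s).length +
        4 * P.γ₁ + P.ℓx ≤
      5 * ((zeros P.γ₁ ++ ones P.γ₁ ++ zeros P.γ₁ ++ ones P.γ₁ ++ zeros P.γ₂).take s).count true +
        10 * P.γ₁ + 5 * P.sx := by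
  have h1 : P.γ₁ = 20 * (P.ℓx + P.ℓy) := rfl
  have h2 : P.γ₂ = 239 * P.ℓx + 240 * P.ℓy + 5 * P.sx := rfl
  simp only [List.append_assoc, List.take_append, List.length_append, List.count_append,
    zeros, ones, List.take_replicate, List.length_replicate, List.count_replicate_self,
    List.count_replicate]
  simp
  omega

/-- **Density of ones in a block** (BK15, proof of Lemma 5.8): every prefix `p` of `G(z) 0^{γ₂}`,
`z` of type `(ℓₓ, sₓ)`, has `|p| ≤ 5 · #1(p)`. [cite: BringmannKunnemannFOCS2015, Lemma 5.8 (proof)] -/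
theorem length_take_block_le (z : List Bool) (hz : z.length = P.ℓx) (hs : z.count true = P.sx)
    (t : ℕ) :
    ((P.guard z ++ zeros P.γ₂).take t).length ≤ 5 * ((P.guard z ++ zeros P.γ₂).take t).count true := by
  have hA := P.length_take_guardHead_le t
  have hB := P.length_take_guardTail_le (t - (4 * P.γ₁ + P.ℓx))
  have hsx : P.sx ≤ P.ℓx := by rw [← hs, ← hz]; exact List.count_le_length
  -- `G(z) 0^{γ₂} = head ++ z ++ tail`
  have hsplit : P.guard z ++ zeros P.γ₂ =
      (ones P.γ₁ ++ zeros P.γ₁ ++ ones P.γ₁ ++ zeros P.γ₁) ++ z ++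
        (zeros P.γ₁ ++ ones P.γ₁ ++ zeros P.γ₁ ++ ones P.γ₁ ++ zeros P.γ₂) := by
    simp [guard, List.append_assoc]
  have hlenA : (ones P.γ₁ ++ zeros P.γ₁ ++ ones P.γ₁ ++ zeros P.γ₁).length = 4 * P.γ₁ := by
    simp only [List.length_append, length_ones, length_zeros]; ring
  have hlenAz : (ones P.γ₁ ++ zeros P.γ₁ ++ ones P.γ₁ ++ zeros P.γ₁ ++ z).length = 4 * P.γ₁ + P.ℓx := by
    rw [List.length_append, hlenA, hz]
  rw [hsplit, List.take_append, List.take_append, List.length_append, List.length_append,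
    List.count_append, List.count_append, hlenAz, hlenA]
  by_cases ht : t ≤ 4 * P.γ₁ + P.ℓx
  · have h0 : t - (4 * P.γ₁ + P.ℓx) = 0 := by omega
    rw [h0, List.take_zero]
    have hzl : (z.take (t - 4 * P.γ₁)).length ≤ t - 4 * P.γ₁ := by
      rw [List.length_take]; exact min_le_left _ _
    have hAl : ((ones P.γ₁ ++ zeros P.γ₁ ++ ones P.γ₁ ++ zeros P.γ₁).take t).length = min t (4 * P.γ₁) := by
      rw [List.length_take, hlenA]
    have h1 : P.γ₁ = 20 * (P.ℓx + P.ℓy) := rfl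
    simp only [List.length_nil, List.count_nil]
    omega
  · push Not at ht
    have hzt : z.take (t - 4 * P.γ₁) = z := List.take_of_length_le (by rw [hz]; omega)
    have hAt : (ones P.γ₁ ++ zeros P.γ₁ ++ ones P.γ₁ ++ zeros P.γ₁).take t =
        ones P.γ₁ ++ zeros P.γ₁ ++ ones P.γ₁ ++ zeros P.γ₁ :=
      List.take_of_length_le (by rw [hlenA]; omega)
    rw [hzt, hz, hs]
    rw [hAt] at hA ⊢
    rw [hlenA] at hA ⊢
    omega

/-- Density of ones in a concatenation of blocks: every prefix `p` of `[G(a)0^{γ₂}]_{a∈as}`, all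
`a` of type `(ℓₓ, sₓ)`, has `|p| ≤ 5 · #1(p)`. [cite: BringmannKunnemannFOCS2015, Lemma 5.8 (proof)] -/
theorem length_take_flatten_blocks_le (as : List (List Bool)) (hlen : ∀ z ∈ as, z.length = P.ℓx)
    (hcnt : ∀ z ∈ as, z.count true = P.sx) (t : ℕ) :
    ((as.map fun z => P.guard z ++ zeros P.γ₂).flatten.take t).length ≤
      5 * ((as.map fun z => P.guard z ++ zeros P.γ₂).flatten.take t).count true := by
  induction as generalizing t with
  | nil => simp
  | cons a as ih =>
      have ha := P.length_take_block_le a (hlen a (by simp)) (hcnt a (by simp)) t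
      have ih' := ih (fun z hz => hlen z (by simp [hz])) (fun z hz => hcnt z (by simp [hz]))
        (t - (P.guard a ++ zeros P.γ₂).length)
      rw [List.map_cons, List.flatten_cons, List.take_append, List.length_append, List.count_append]
      omega

/-- `x 0^{γ₂} = [G(xᵢ)0^{γ₂}]ᵢ`: the gadget string followed by one more separator is the
concatenation of the blocks. [cite: BringmannKunnemannFOCS2015, Lemma 5.3] -/
theorem gadgetX_append_zeros {xs : List (List Bool)} (hxs : xs ≠ []) :
    P.gadgetX xs ++ zeros P.γ₂ = (xs.map fun z => P.guard z ++ zeros P.γ₂).flatten := by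
  induction xs with
  | nil => exact absurd rfl hxs
  | cons a xs ih =>
      rcases xs with _ | ⟨b, xs'⟩
      · simp
      · rw [P.gadgetX_cons a (List.cons_ne_nil _ _), List.append_assoc (P.guard a ++ zeros P.γ₂),
          ih (List.cons_ne_nil _ _)]
        simp only [List.map_cons, List.flatten_cons, List.append_assoc]

/-- **Lemma 5.8, combinatorial core** (Bringmann–Künnemann, FOCS 2015): every prefix `x'` of
`x = G(x₁) 0^{γ₂} ⋯ G(x_n)` (inputs of type `(ℓₓ, sₓ)`) satisfies `|x'| ≤ 5 · #1(x')` ("the relative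
number of ones of any prefix of `x` is at least `1/5`"). [cite: BringmannKunnemannFOCS2015, Lemma 5.8] -/
theorem length_take_gadgetX_le_five_mul_count (xs : List (List Bool))
    (hlen : ∀ z ∈ xs, z.length = P.ℓx) (hcnt : ∀ z ∈ xs, z.count true = P.sx) (t : ℕ) :
    ((P.gadgetX xs).take t).length ≤ 5 * ((P.gadgetX xs).take t).count true := by
  rcases eq_or_ne xs [] with rfl | hxs
  · simp
  · have h := P.length_take_flatten_blocks_le xs hlen hcnt t
    rw [← P.gadgetX_append_zeros hxs, List.take_append, List.length_append, List.count_append,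
      count_true_zeros_take] at h
    · omega
where
  /-- A prefix of `0^k` has no ones. [folklore] -/
  count_true_zeros_take {k s : ℕ} : ((zeros k).take s).count true = 0 := by
    simp [zeros, List.take_replicate, List.count_replicate]

/-- Lemma 5.8 for suffixes (BK15: "symmetric statements hold for any suffix of `x`"): every suffix
`x''` of `x` satisfies `|x''| ≤ 5 · #1(x'')`, by reversal. [cite: BringmannKunnemannFOCS2015, Lemma 5.8] -/
theorem length_drop_gadgetX_le_five_mul_count (xs : List (List Bool))
    (hlen : ∀ z ∈ xs, z.length = P.ℓx) (hcnt : ∀ z ∈ xs, z.count true = P.sx) (a : ℕ) :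
    ((P.gadgetX xs).drop a).length ≤ 5 * ((P.gadgetX xs).drop a).count true := by
  set x := P.gadgetX xs with hx
  have hrev : (x.drop a).reverse = x.reverse.take (x.drop a).length := by
    conv_rhs => rw [← List.take_append_drop a x, List.reverse_append]
    rw [List.take_left' (by simp)]
  have h := P.length_take_gadgetX_le_five_mul_count (xs.map List.reverse).reverse
    (fun z hz => ?_) (fun z hz => ?_) (x.drop a).length
  · rw [← P.reverse_gadgetX xs, ← hx, ← hrev, List.length_reverse, List.count_reverse] at h
    exact h
  · simp only [List.mem_reverse, List.mem_map] at hz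
    obtain ⟨w, hw, rfl⟩ := hz
    rw [List.length_reverse, hlen w hw]
  · simp only [List.mem_reverse, List.mem_map] at hz
    obtain ⟨w, hw, rfl⟩ := hz
    rw [List.count_reverse, hcnt w hw]

/-! ### Lemma 5.8: distances to a block of zeros -/

/-- **Lemma 5.8, lower bound, prefixes** (Bringmann–Künnemann, FOCS 2015; `β = 4/5`, scaled by
`5`): for every prefix `x'` of `x` and every `N`, `5N ≤ 5·editDist x' 0^N + 4|x'|`
(print: `editDist x' Lʸ ≥ nγ₃ - β|x'|` for `N = nγ₃`). [cite: BringmannKunnemannFOCS2015, Lemma 5.8] -/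
theorem five_mul_le_editDist_take_gadgetX (xs : List (List Bool))
    (hlen : ∀ z ∈ xs, z.length = P.ℓx) (hcnt : ∀ z ∈ xs, z.count true = P.sx) (t N : ℕ) :
    5 * N ≤ 5 * editDist ((P.gadgetX xs).take t) (zeros N) + 4 * ((P.gadgetX xs).take t).length := by
  have h1 : N ≤ editDist ((P.gadgetX xs).take t) (zeros N) + ((P.gadgetX xs).take t).count false :=
    le_editDist_replicate_add_count ((P.gadgetX xs).take t) false N
  have h2 := count_true_add_count_false ((P.gadgetX xs).take t)
  have h3 := P.length_take_gadgetX_le_five_mul_count xs hlen hcnt t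
  omega

/-- **Lemma 5.8, lower bound, suffixes** (BK15, "symmetric statements hold for `editDist x'' Rʸ`
where `x''` is any suffix of `x`"): `5N ≤ 5·editDist x'' 0^N + 4|x''|`. [cite: BringmannKunnemannFOCS2015, Lemma 5.8] -/
theorem five_mul_le_editDist_drop_gadgetX (xs : List (List Bool))
    (hlen : ∀ z ∈ xs, z.length = P.ℓx) (hcnt : ∀ z ∈ xs, z.count true = P.sx) (a N : ℕ) :
    5 * N ≤ 5 * editDist ((P.gadgetX xs).drop a) (zeros N) + 4 * ((P.gadgetX xs).drop a).length := by
  have h1 : N ≤ editDist ((P.gadgetX xs).drop a) (zeros N) + ((P.gadgetX xs).drop a).count false :=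
    le_editDist_replicate_add_count ((P.gadgetX xs).drop a) false N
  have h2 := count_true_add_count_false ((P.gadgetX xs).drop a)
  have h3 := P.length_drop_gadgetX_le_five_mul_count xs hlen hcnt a
  omega

/-- **Lemma 5.8, equality for the special prefixes** (BK15: equality "if `x'` is of the form
`G(x₁)0^{γ₂} ⋯ G(xᵢ)0^{γ₂}`"): for `x' = [G(a)0^{γ₂}]_{a∈as}` with `|x'| ≤ N`,
`editDist x' 0^N + 4·|as|·(4γ₁+sₓ) = N`, i.e. `editDist x' 0^N = N - β|x'|`.
[cite: BringmannKunnemannFOCS2015, Lemma 5.8] -/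
theorem editDist_flatten_blocks_zeros (as : List (List Bool)) (hlen : ∀ z ∈ as, z.length = P.ℓx)
    (hcnt : ∀ z ∈ as, z.count true = P.sx) (N : ℕ)
    (hN : (as.map fun z => P.guard z ++ zeros P.γ₂).flatten.length ≤ N) :
    editDist (as.map fun z => P.guard z ++ zeros P.γ₂).flatten (zeros N) +
      4 * (as.length * (4 * P.γ₁ + P.sx)) = N := by
  have h1 : editDist (as.map fun z => P.guard z ++ zeros P.γ₂).flatten (zeros N) +
      (as.map fun z => P.guard z ++ zeros P.γ₂).flatten.count false = N :=
    editDist_replicate_add_count (as.map fun z => P.guard z ++ zeros P.γ₂).flatten false N hN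
  have h2 := count_true_add_count_false (as.map fun z => P.guard z ++ zeros P.γ₂).flatten
  have h3 : (as.map fun z => P.guard z ++ zeros P.γ₂).flatten.length =
      5 * (as.length * (4 * P.γ₁ + P.sx)) := by
    rw [P.length_flatten_map_guard_append_zeros as hlen]; ring
  have h4 := P.count_true_flatten_map_guard_append_zeros as hcnt
  rw [h3, h4] at h2
  omega

/-- Lemma 5.8, equality for the special suffixes `x'' = [0^{γ₂}G(c)]_{c∈cs}` with `|x''| ≤ N`:
`editDist x'' 0^N + 4·|cs|·(4γ₁+sₓ) = N`. [cite: BringmannKunnemannFOCS2015, Lemma 5.8] -/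
theorem editDist_flatten_blocks'_zeros (cs : List (List Bool)) (hlen : ∀ z ∈ cs, z.length = P.ℓx)
    (hcnt : ∀ z ∈ cs, z.count true = P.sx) (N : ℕ)
    (hN : (cs.map fun z => zeros P.γ₂ ++ P.guard z).flatten.length ≤ N) :
    editDist (cs.map fun z => zeros P.γ₂ ++ P.guard z).flatten (zeros N) +
      4 * (cs.length * (4 * P.γ₁ + P.sx)) = N := by
  have h1 : editDist (cs.map fun z => zeros P.γ₂ ++ P.guard z).flatten (zeros N) +
      (cs.map fun z => zeros P.γ₂ ++ P.guard z).flatten.count false = N :=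
    editDist_replicate_add_count (cs.map fun z => zeros P.γ₂ ++ P.guard z).flatten false N hN
  have h2 := count_true_add_count_false (cs.map fun z => zeros P.γ₂ ++ P.guard z).flatten
  have h3 : (cs.map fun z => zeros P.γ₂ ++ P.guard z).flatten.length =
      5 * (cs.length * (4 * P.γ₁ + P.sx)) := by
    rw [P.length_flatten_map_zeros_append_guard cs hlen]; ring
  have h4 := P.count_true_flatten_map_zeros_append_guard cs hcnt
  rw [h3, h4] at h2
  omega

end Params

end BKGadget

end Literature.Computability.FineGrained
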